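import Summits.NavierStokesRegularity.NavierStokesRegularity.Theses.TautLoopKelvin
import Summits.NavierStokesRegularity.NavierStokesRegularity.Theorems.RungReynoldsOne.Negative.WithoutLerayHopfFalse
import Summits.NavierStokesRegularity.NavierStokesRegularity.Theorems.BlowupAssembly
import Summits.NavierStokesRegularity.NavierStokesRegularity.Theorems.BlowupBlowupClayNonuniquenessRefutation
import Literature.Analysis.FluidPDE.NSQuasipotential
import Literature.Analysis.FluidPDE.LoopCirculation

/-!
# `CirculationFloor` (stmt-NavierStokesRegularity-1538): load-bearing hypotheses and the Clay vacuity

Negative (support) lemmas for the crux `TautLoopKelvin.CirculationFloor` = `CirculationRelay.CirculationFloor`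
(the shared entry ticket stmt-NavierStokesRegularity-1538 of the routes TautLoopKelvin, rank 4, and
CirculationRelay, rank 9), from the refuter's crux attack (2026-08-17). The crux: there is an absolute
`c₀ > 0` such that every classical Leray–Hopf solution of unforced Navier–Stokes on `ℝ³ × [0,T)` from a
rapidly decaying datum WITHOUT smooth extension past `T` carries, for every `δ > 0`, a planar circle of
radius `0 < r ≤ δ` at some `t < T` with circulation `|∮ u(t)·dl| ≥ c₀ ν` (the loop form of the
Cheskidov–Shvydkoy `B^{-1}_{∞,∞}` criterion, arXiv:0708.3067 Lemma 3.2).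

* `circle_inner_const_integral_eq_zero` — a constant field has zero circulation around every planar
  circle (the route's angle integral; `circulation_const_left` ∘ `circulation_circleLoop`).
* `circulationFloor_false_without_noExtension` — drop `¬ HasSmoothExtensionPast`: FALSE (the rest state
  `u ≡ 0` is classical, Leray–Hopf, Schwartz, and every circulation is `0 < c₀ ν`).
* `circulationFloor_false_without_LerayHopf` — drop `IsLerayHopfOn` (finite energy): FALSE, by the
  Koch–Nadirashvili–Seregin–Šverák parasitic drift `u = g(t)·driftDir`, `p = −g′(t) x₀`,
  `g(t) = (1−t)^{-1/2} − 1` of `RungReynoldsOne/Negative/WithoutLerayHopfFalse.lean`: classical on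
  `[0,1) × ℝ³` for every viscosity, datum `0`, no classical extension past `t = 1`, and — being spatially
  constant — with ZERO circulation on every loop at every time. MORAL: any proof must spend the energy
  class (in the intended proof: `u(t) ∈ L²` makes `Δ̇_j u = ∇G_j ×̇ ω` legitimate and pays the kernel tails;
  weak–strong uniqueness is what makes "no extension" a genuine singularity).
* `not_navierStokesRegularity_of_not_circulationFloor` — the crux is a THEOREM OF CLAY (A): a disproof of
  `CirculationFloor` exhibits a finite-energy classical blow-up from a rapidly decaying datum, which with the
  proved uniqueness `X5b` (`BlowupBlowupClayNonuniqueness_refuted`, Tao 2013 Cor. 11.4) refutes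
  `NavierStokesRegularity` (`Literature.NS.blowup_assembly`). So the item can be closed `refuted` only by a
  negative solution of the Millennium problem; what can fail is provability of the intended
  circulation → Besov conversion, not validity.

[cite: KochNadirashviliSereginSverak2009, §1 p. 3 (parasitic solutions `u = g(t)`, `p = −g′·x`)]
-/

noncomputable section

set_option linter.dupNamespace false

namespace Summit.NavierStokesRegularity.NavierStokesRegularity.Theorems.CirculationFloor.Negative

open Set Filter Topology MeasureTheory Real
open scoped InnerProductSpace RealInnerProductSpace
open Literature.Analysis.FluidPDE
open Summit.NavierStokesRegularity.NavierStokesRegularity.Theorems.RungReynoldsOneNegative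
open Summit.NavierStokesRegularity.NavierStokesRegularity.Theses

/-- **A constant field has zero circulation around every planar circle**, in the route's angle-integral
form: `∫₀^{2π} ⟪a, −(r sin θ) e₁ + (r cos θ) e₂⟫ dθ = 0` (any centre, any frame, any `r`). [folklore] -/
theorem circle_inner_const_integral_eq_zero (a c e₁ e₂ : EuclideanSpace ℝ (Fin 3)) (r : ℝ) :
    ∫ θ in (0 : ℝ)..2 * π, ⟪(fun _ : EuclideanSpace ℝ (Fin 3) => a) (c + (r * cos θ) • e₁ + (r * sin θ) • e₂),
      (-(r * sin θ)) • e₁ + (r * cos θ) • e₂⟫ = 0 := by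
  have hloop : circleLoop c r e₁ e₂ 0 = circleLoop c r e₁ e₂ 1 := by
    have h := periodic_circleLoop c r e₁ e₂ 0
    rw [zero_add] at h
    exact h.symm
  have h1 : circulation (fun _ : EuclideanSpace ℝ (Fin 3) => a) (circleLoop c r e₁ e₂) = 0 :=
    circulation_const_left (contDiff_circleLoop c r e₁ e₂) hloop a
  rwa [circulation_circleLoop] at h1

/-- **`¬ HasSmoothExtensionPast` is load-bearing.** `CirculationFloor` with the no-extension hypothesis
deleted is FALSE: the rest state `u ≡ 0`, `p ≡ 0` (`ν = T = δ = 1`) is a classical Leray–Hopf solution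
from the Schwartz datum `0`, and every circle circulation is `0 < c₀ ν`. [folklore] -/
theorem circulationFloor_false_without_noExtension :
    ¬ (∃ c₀ : ℝ, 0 < c₀ ∧ ∀ (ν T : ℝ), 0 < ν → 0 < T →
      ∀ (u : ℝ → EuclideanSpace ℝ (Fin 3) → EuclideanSpace ℝ (Fin 3)) (p : ℝ → EuclideanSpace ℝ (Fin 3) → ℝ),
        IsClassicalNSSolutionOn (Set.Ico 0 T) ν 0 u p → IsLerayHopfOn T ν 0 (u 0) u →
        HasRapidSpatialDecay (u 0) →
        ∀ δ : ℝ, 0 < δ → ∃ t ∈ Set.Ico 0 T, ∃ (c e₁ e₂ : EuclideanSpace ℝ (Fin 3)) (r : ℝ),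
          0 < r ∧ r ≤ δ ∧ ‖e₁‖ = 1 ∧ ‖e₂‖ = 1 ∧ inner ℝ e₁ e₂ = 0 ∧
          c₀ * ν ≤ |∫ θ in (0 : ℝ)..(2 * Real.pi), inner ℝ (u t (c + (r * Real.cos θ) • e₁ + (r * Real.sin θ) • e₂))
            ((-(r * Real.sin θ)) • e₁ + (r * Real.cos θ) • e₂)|) := by
  rintro ⟨c₀, hc₀, h⟩
  have hdec0 : HasRapidSpatialDecay (0 : EuclideanSpace ℝ (Fin 3) → EuclideanSpace ℝ (Fin 3)) := by
    simpa [drift_zero (gI_zero 1)] using drift_rapidDecay (g := gI 1) (gI_zero 1)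
  obtain ⟨t, -, c, e₁, e₂, r, -, -, -, -, -, hle⟩ := h 1 1 one_pos one_pos 0 0
    (isClassicalNSSolutionOn_zero _ _) (isLerayHopfOn_zero (E := EuclideanSpace ℝ (Fin 3)) 1 1) hdec0 1 one_pos
  have h0 : ∫ θ in (0 : ℝ)..(2 * Real.pi),
      inner ℝ ((0 : ℝ → EuclideanSpace ℝ (Fin 3) → EuclideanSpace ℝ (Fin 3)) t (c + (r * Real.cos θ) • e₁ + (r * Real.sin θ) • e₂))
        ((-(r * Real.sin θ)) • e₁ + (r * Real.cos θ) • e₂) = 0 :=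
    circle_inner_const_integral_eq_zero 0 c e₁ e₂ r
  rw [h0, abs_zero, mul_one] at hle
  exact absurd hle (not_le.2 hc₀)

/-- **`IsLerayHopfOn` (finite energy) is load-bearing.** `CirculationFloor` with the Leray–Hopf hypothesis
deleted is FALSE: the parasitic drift `u = g(t)·driftDir`, `p = −g′(t) x₀`, `g(t) = (1−t)^{-1/2} − 1`
(`ν = T = δ = 1`) is classical on `[0,1) × ℝ³`, starts from the Schwartz datum `0`, has no classical
extension past `1` (`|g| → ∞`), and all its circle circulations vanish (spatially constant slices). [folklore] -/
theorem circulationFloor_false_without_LerayHopf :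
    ¬ (∃ c₀ : ℝ, 0 < c₀ ∧ ∀ (ν T : ℝ), 0 < ν → 0 < T →
      ∀ (u : ℝ → EuclideanSpace ℝ (Fin 3) → EuclideanSpace ℝ (Fin 3)) (p : ℝ → EuclideanSpace ℝ (Fin 3) → ℝ),
        IsClassicalNSSolutionOn (Set.Ico 0 T) ν 0 u p →
        HasRapidSpatialDecay (u 0) → ¬ HasSmoothExtensionPast ν 0 u T →
        ∀ δ : ℝ, 0 < δ → ∃ t ∈ Set.Ico 0 T, ∃ (c e₁ e₂ : EuclideanSpace ℝ (Fin 3)) (r : ℝ),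
          0 < r ∧ r ≤ δ ∧ ‖e₁‖ = 1 ∧ ‖e₂‖ = 1 ∧ inner ℝ e₁ e₂ = 0 ∧
          c₀ * ν ≤ |∫ θ in (0 : ℝ)..(2 * Real.pi), inner ℝ (u t (c + (r * Real.cos θ) • e₁ + (r * Real.sin θ) • e₂))
            ((-(r * Real.sin θ)) • e₁ + (r * Real.cos θ) • e₂)|) := by
  rintro ⟨c₀, hc₀, h⟩
  obtain ⟨t, -, c, e₁, e₂, r, -, -, -, -, -, hle⟩ := h 1 1 one_pos one_pos (drift (gI 1)) (driftP (gI 1))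
    (drift_isClassical (gI_contDiffOn 1) 1) (drift_rapidDecay (gI_zero 1))
    (drift_not_hasSmoothExtensionPast (tendsto_abs_gI_atTop 1 one_pos) 1) 1 one_pos
  have h0 : ∫ θ in (0 : ℝ)..(2 * Real.pi),
      inner ℝ (drift (gI 1) t (c + (r * Real.cos θ) • e₁ + (r * Real.sin θ) • e₂))
        ((-(r * Real.sin θ)) • e₁ + (r * Real.cos θ) • e₂) = 0 :=
    circle_inner_const_integral_eq_zero (gI 1 t • driftDir) c e₁ e₂ r
  rw [h0, abs_zero, mul_one] at hle
  exact absurd hle (not_le.2 hc₀)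

/-- **The crux is a theorem of Clay (A).** A disproof of `CirculationFloor` refutes `NavierStokesRegularity`:
its witness is a classical Leray–Hopf solution from a rapidly decaying datum with no smooth extension past `T`,
i.e. `X5a`, and `X5a ∧ X5b → ¬(A)` (`Literature.NS.blowup_assembly`) with `X5b` proved
(`BlowupBlowupClayNonuniqueness_refuted`). Hence the item can only be closed `refuted` together with the
summit; conversely `NavierStokesRegularity → CirculationFloor` (with any constant, e.g. `c₀ = 1`). [folklore] -/
theorem not_navierStokesRegularity_of_not_circulationFloor (h : ¬ TautLoopKelvin.CirculationFloor) :
    ¬ _root_.NavierStokesRegularity := by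
  intro hA
  apply h
  refine ⟨1, one_pos, ?_⟩
  intro ν T hν hT u p hcl hLH hdec hext δ _
  exact absurd hA (Literature.NS.blowup_assembly ⟨⟨ν, hν, T, hT, u, p, ⟨hcl, hext⟩, hLH, hdec⟩,
    not_not.1 Summit.NavierStokesRegularity.NavierStokesRegularity.Theorems.BlowupBlowupClayNonuniqueness_refuted⟩)

end Summit.NavierStokesRegularity.NavierStokesRegularity.Theorems.CirculationFloor.Negative

end
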